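import Summits.QuantumFields.YangMills.Theorems.BalabanUVNodesN22AtRecordOfKernelFadingSector

/-!
# BalabanUVNodes ∕ node N22 = NE9 — THE AGE-WEIGHTED EDITIONS OF THE KERNEL-FADING ROAD: K3's `h9` WITH THE RECORD's GEOMETRIC MODULI from node N18's kernel step rate +
# second differences in each young coupling whose constants GROW GEOMETRICALLY IN THE AGE at a ratio `q ≥ 1`, under the row `ℓ.θ₅·q ≤ ℓ.ω²` — ROAD 2's FULL WINDOW at the
# ₁₃ record (J38 ∕ J45 ∕ J46 pinned `q = 1`)

Cell `pub-ymgap`, HUMAN RULING D-0062 (Track A), R134 seat `pub-ymgap-dag-n22-c` (strategy s1), generation 16, module J48.  THEOREMS ONLY (no `def`, no `sorry`, standard axioms);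
`--kind proof --supports stmt-QuantumFields-27366 --as helper` (K3⁸ `SpineGivenEndpointR13SepCoPHV`, skeleton v6 — §2b N22 face `h9` verbatim), COUNT-NEUTRAL.  Imports module J46
`…N22AtRecordOfKernelFadingSector` (through it J45 `…N22KernelFadingOfTermSecondDiff`, J38 `…N22KernelFadingOfStepRate`, J39's window engine, dag-n22-a's `…N22KnitDiscrete`).
Nothing re-declared; §1–§2 are J45 §2–§3 with a COORDINATE-DEPENDENT constant, §3–§4 are J38 §2–§3 at a general growth ratio.

WHY (LOCATED, dag-n22-a's own reading — `…N22KnitDiscrete` §3 «fading iff θμ < 1», `…N22KnitRecursion` header «ROAD 2 closes N22 whenever ω + c < θ^{−1∕2} — a window STRICTLY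
LARGER than N2's ω + c < 1», dag-n22-w1's `…N22KnitRoadRatesSharp` «(R₂) ≤ M·μ^{age−1}e^{−κd}d² ⟹ fading at every τ ≥ √(θμ); with UNIFORM M (μ = 1) the rate √θ … ROAD 2 is the one
dag-n22-c's J38 carries to the kernel record, booking ℓ.θ₅ ≤ ℓ.ω²»).  ROAD 2 (`N22KnitDiscrete.ne9_and_fadingMemory_of_osc_secondDiff`) takes the second-difference clause (R₂) with
constants `M·μ^{age}` GROWING geometrically in the age of the coordinate; the one in-tree producer SHAPE for (R₂) in the OLDER coordinates — dag-n22-a's second-order step recursion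
`N22KnitRecursion.secondDiff_of_stepSecondDiff` (the chain rule through [I] (2.13)'s curly bracket) — delivers exactly such growing profiles, at any ratio above the recursion's
first-order growth `ω₁ + c` and its square, with NO smallness; an age-UNIFORM constant (`μ = 1`) comes out of that recursion only under `ω₁ + c < 1`, i.e. ROAD 1's clause N2 — the
clause ROAD 2 exists to avoid.  This lane's J38 §2–§3, J45 §2–§3 and J46 §1–§3 (and every print-level twin) pinned `μ = 1`: their (R₂)∕letter∕sector inputs ask producers for an
age-uniform constant in the older coordinates.  THIS FILE restores ROAD 2's full window at the ₁₃ record: every second-difference input may grow like `q^{k−i}` (`q ≥ 1`), the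
letter row becomes `ℓ.θ₅·q ≤ ℓ.ω²` (`ℓ.ω ≥ √(θ₅q)`, dag-n22-w1's sharp exponent), everything else verbatim; `q = 1` is J38∕J45∕J46 on the nose.
* §1 ★ `windowedSecondDiff_localizedSum_of_termSecondDiffAt` — J45 §2 with a COORDINATE-DEPENDENT term-level letter `M₂ k i` (any nonnegative table): the windowed second
  differences at `(k, i)` are eventually `≤ (16·M₂ k i·B₃²∕r²)·e^{12Mδ₁}K₀K₁·d²·e^{−δ₁|z|₁}` (the proof is J45's, pointwise in `(k, i)`).
* §2 ★ `kernelSecondDiff_objectsOfRecord₁₃_of_termSecondDiffAt` — J45 §3 with the table: (R₂) at the kernel functional of record with constant `C₂(M₂ (scale X − 1) i)`.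
* §3 ★★★ `ne9_and_fadingMemory_EA_of_kernelStepRate_secondDiffGrowing` — J38 §2 at a general growth ratio `q ≥ 0` (generic term family `ℰ`): N18's `KernelStepRate` + `DecayBound` +
  (R₂) `≤ M·q^{k−i}·e^{−κ|z|₁}·d²` + a step ratio `ϱ ∈ ]0, 1]` and a rate `τ > 0` with `θ ≤ τϱ`, `qϱ ≤ τ` ⟹ `NE9 (EA F ℰ ρ bV) (Window γ) κ (C₉τ^{k−i}) ∧ FadingMemory C₉ τ _`.
* §4 ★★★ `ne9_EA_objectsOfRecord₁₃_of_kernelStepRate_secondDiffGrowing` — J38 §3 at the record with growth: rows `1 ≤ q`, `ℓ.θ₅·q ≤ ℓ.ω²`, `ℓ.κ ≤ κ`, the `C₉` row ⟹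
  **`NE9 ((objectsOfRecord₁₃ F N θ ℓ).EA 0) (Window θ.γ) ℓ.κ ℓ.moduli`** (§3 at `τ := ℓ.ω`, `ϱ := ℓ.ω∕q`).
* §5 ★ `exists_letterBlock_rows_growing` — A5 rider: the growth rows are jointly satisfiable with `ℓ.Signs` iff `θ₅·q < 1` (J42 §2 at ratio `q`).
Module J49 (`…N22AtRecordOfKernelFadingAgeWeighted`) carries §2 + §4 to the term-level letter, the printed output bound, the SECTOR datum with growing constants and the pin face.

HONEST FRAMING (binding).  Count-neutral COMPOSITION ∕ re-keying of landed theorems; NO estimate of Bałaban's is proved or asserted; nothing of the record is constructed or claimed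
to meet the displayed inputs (N18's kernel step rate: node N18 — NE5 NOT PRINTED for d = 4; the second-difference table: N09 for the last coupling, N10 ∕ NODE A ∕ def-W1's generator
for the older ones — [I] p. 263's «C^∞ … (or analytic)» clause read at second order, NOTHING quantitative being printed for the older couplings; term holomorphy through the readings,
chart ∕ space clauses, tails: NODE A ∕ N09; W1-20's law: NODE A ∕ def-W1; (1.21): dag-n22-w3's road); N22 is NOT discharged (typed 28∕28 · discharged 5∕27 UNCHANGED); K3⁸ OPEN and
NOT claimed (no stub of 27366 touched); NE9 is NOT IN PRINT for d = 4; no count claim; one finite 𝕋⁴ programme at fixed ε — R4 closes the CONDITIONAL rung `BalabanLadder.UV` only;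
NOTHING about the continuum limit, ℝ⁴, infinite volume, OS axioms, a mass gap or the Clay problem is proved or claimed.  References (TYPES only, no cite tags on the Summit side):
[I] = Bałaban, CMP 109 (1987) Thm 1 p. 259, §0 p. 256, §1 p. 263 with (1.18), (1.20)–(1.22) p. 264, (2.12)–(2.13) p. 268, p. 282 (site-weight tails: the sentence after (4.4)),
(4.35)–(4.37) pp. 290–291, (5.10) p. 293, §5 p. 298; [II] = CMP 116 (1988) (2.13)–(2.14) pp. 14–15; King, CMP 102 (1986) Lemma 4.5 (the N18 mechanism's print).
-/

noncomputable section

open Filter Topology Set Metric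
open scoped BigOperators

namespace YMDAG.N22.KernelFading

open Literature.MathematicalPhysics.QuantumFieldTheory.Balaban1983to89
open Literature.MathematicalPhysics.QuantumFieldTheory.Balaban1983to89.T4Continuum (T4Family)
open Literature.MathematicalPhysics.QuantumFieldTheory.Balaban1983to89.T4OutputRate (Carriers Functional Window NE9 FadingMemory DecayBound PrefixDependenceOn)
open Literature.MathematicalPhysics.QuantumFieldTheory.Balaban1983to89.TreeLengthTorus (TPt torusTreeLen torusTreeLen_nonneg)
open Literature.MathematicalPhysics.QuantumFieldTheory.Balaban1983to89.B12TreeDecay (K₀ kappa₀ K₀_pos)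
open Literature.MathematicalPhysics.QuantumFieldTheory.Balaban1983to89.B12PolarizationTensor120 (expChart expChart_apply)
open Literature.MathematicalPhysics.QuantumFieldTheory.Balaban1983to89.B12Decay510 (delta1)
open Literature.MathematicalPhysics.QuantumFieldTheory.Balaban1983to89.B12Decay510Window (K₁ K₁_nonneg)
open Literature.MathematicalPhysics.QuantumFieldTheory.Balaban1983to89.B12Decay510Torus (distCT nearT)
open Literature.MathematicalPhysics.QuantumFieldTheory.Balaban1983to89.B12Sec2to5 (l1 l1_nonneg)
open Literature.MathematicalPhysics.QuantumFieldTheory.Balaban1983to89.Node00 (TermFamily1 polWindow siteOfInt mergedTermFamilyMatT TβOfRecord₁₃ chiβOfRecord₁₃ Stage13Params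
  U3Letters₁₁ MatA)
open Literature.MathematicalPhysics.QuantumFieldTheory.Balaban1983to89.Node00.Sect2 (domSys domCount CPair)
open Literature.MathematicalPhysics.QuantumFieldTheory.Balaban1983to89.Node00.W1
open Literature.MathematicalPhysics.QuantumFieldTheory.Balaban1983to89.Node00.LocalizedSum17 (localizedSum ReadingMaps Localizes17OfRecord₁₃)
open Literature.MathematicalPhysics.QuantumFieldTheory.Balaban1983to89.Node00.U3OfKernels (carriers histPrefix kernelA EA objectsOfRecord₁₃ kernelA_eq EA_apply)
open Literature.MathematicalPhysics.QuantumFieldTheory.Balaban1983to89.Node00.U3KernelLetters (KernelStepRate KernelStepRateOfRecord₁₃ PolLimitsExistOfRecord₁₃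
  polLimitsExistOfRecord₁₃_iff polWindow_eventuallyEq_of_eventuallyAgree)
open YMDAG.N22.WindowSoftTwoPoint (eventually_le_of_softSum_domSys)
open YMDAG.N22.OutputLevel (outputValueSummand_le_softMajorant)
open YMDAG.N22.WindowedSecondDiff (abs_secondDiff_polWindow_localizedSum_le_soft histPrefix_update)
open Summit.QuantumFields.YangMills.BalabanUVNodes.N22KnitDiscrete (ne9_and_fadingMemory_of_osc_secondDiff)

open scoped Matrix.Norms.L2Operator

/-! ## §1 The windowed second-difference letter from a COORDINATE-DEPENDENT term-level letter (J45 §2, pointwise in `(k, i)`) -/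

section Letter

variable (F : T4Family) {𝔄 : Type*} [NormedRing 𝔄] [NormedAlgebra ℝ 𝔄] {V : Type*} [NormedAddCommGroup V] [NormedSpace ℝ V]
  {ι' : Type*} [Fintype ι'] {𝔸 : Type*} {M : ℕ}

open Classical in
/-- ★ **THE WINDOWED SECOND-DIFFERENCE LETTER FROM A TERM-LEVEL LETTER WITH A COORDINATE-DEPENDENT CONSTANT.**  J45 §2 `windowedSecondDiff_localizedSum_of_termSecondDiff` with
the one constant `M₂` replaced by a nonnegative TABLE `M₂ k i` (level `k`, young coordinate `i ≤ k`; e.g. `M₂·q^{k−i}`): for node00-def-W1's towers `S K` read through `emb` and a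
chart `(ρ, bV)`, IF the (2.13) term has second differences in `g_i` bounded by `M₂ k i·e^{−κ_E d_{k+1}(X)}·d²` on `]0, γ]` (every torus, level, coordinate, box history, domain,
admissible configuration), AND the term is holomorphic through complexified probe readings at every window history (open `U ⊇ ball 0 r`, chart clause, space clause), with site weights
`w ≤ B₃e^{−δ₀·dist}` and `2κ₀(64,8) ≤ κ ≤ κ_E`, THEN at every `(k, i)` the second differences of the WINDOWED kernels are eventually (in `K`)
`≤ (16·M₂ k i·B₃²∕r²)·e^{12Mδ₁}·K₀(64,8)·K₁(4,δ₀∕2)·d²·e^{−δ₁|z|₁}` — J45 §2's proof verbatim (it is pointwise in `(k, i)`). [folklore] -/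
theorem windowedSecondDiff_localizedSum_of_termSecondDiffAt (m' : ℕ) (M : ℕ) [NeZero M] (hM : M = F.L ^ m')
    (S : (K : ℕ) → ClusterTower (F.P K) 𝔸 M) (emb : ReadingMaps F 𝔄 𝔸) (ρ : V →L[ℝ] 𝔄) (bV : Module.Basis ι' ℝ V)
    {γ : ℝ} (sp : (K k : ℕ) → (domSys (F.P K) M (k + 1)).Dom → Set (CPair (F.P K) 𝔸))
    {κ κE δ₀ B₃ r : ℝ} {M₂ : ℕ → ℕ → ℝ}
    (hκ₀ : kappa₀ (4 * 2 ^ 4) (2 * 4) ≤ κ / 2) (hδ₀ : 0 < δ₀) (hB₃ : 0 ≤ B₃) (hr : 0 < r) (hM₂ : ∀ k i, 0 ≤ M₂ k i) (hκE : κ ≤ κE)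
    (hΔ : ∀ (K k : ℕ) (i : Fin (k + 1)), ∀ g ∈ box γ k, ∀ (X : (domSys (F.P K) M (k + 1)).Dom), ∀ φ ∈ sp K k X, ∀ t d : ℝ, 0 < d →
      t - d ∈ Ioc (0 : ℝ) γ → t + d ∈ Ioc (0 : ℝ) γ →
        ‖((S K) k).E (Function.update g i (t + d)) φ X - 2 * ((S K) k).E (Function.update g i t) φ X + ((S K) k).E (Function.update g i (t - d)) φ X‖ ≤
          M₂ k i * Real.exp (-(κE * (domSys (F.P K) M (k + 1)).dj X)) * d ^ 2)
    (Ec : ℕ → ℕ → Type*) [∀ K k, NormedAddCommGroup (Ec K k)] [∀ K k, NormedSpace ℂ (Ec K k)]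
    (ι : (K k : ℕ) → (domSys (F.P K) M (k + 1)).Dom → ((Fin (F.P K).d → Site (F.P K) (k + 1) → V) →L[ℝ] Ec K k))
    (Φ : (K k : ℕ) → (domSys (F.P K) M (k + 1)).Dom → Ec K k → CPair (F.P K) 𝔸)
    (U : (K k : ℕ) → (domSys (F.P K) M (k + 1)).Dom → Set (Ec K k)) (hU : ∀ K k X, IsOpen (U K k X)) (hrU : ∀ K k X, ball (0 : Ec K k) r ⊆ U K k X)
    (hEhol : ∀ g ∈ Window γ, ∀ (K k : ℕ) (X : (domSys (F.P K) M (k + 1)).Dom),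
      DifferentiableOn ℂ (fun z => ((S K) k).E (histPrefix g k) (Φ K k X z) X) (U K k X))
    (hΦemb : ∀ (K k : ℕ) (X : (domSys (F.P K) M (k + 1)).Dom) (Bf : Fin (F.P K).d → Site (F.P K) (k + 1) → V),
      Φ K k X (ι K k X Bf) = emb K k (fun l t => NormedSpace.exp (ρ (Bf l t))))
    (hΦsp : ∀ (K k : ℕ) (X : (domSys (F.P K) M (k + 1)).Dom), ∀ z ∈ ball (0 : Ec K k) r, Φ K k X z ∈ sp K k X)
    (w : (K k : ℕ) → (domSys (F.P K) M (k + 1)).Dom → Site (F.P K) (k + 1) → ℝ) (hw₀ : ∀ K k X t, 0 ≤ w K k X t)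
    (hw : ∀ (K k : ℕ) (X : (domSys (F.P K) M (k + 1)).Dom) (l : Fin (F.P K).d) (t : Site (F.P K) (k + 1)) (c : ι'),
      ‖ι K k X (Pi.single l (Pi.single t (bV c)))‖ ≤ w K k X t)
    (htail : ∀ (K k : ℕ) (X : (domSys (F.P K) M (k + 1)).Dom) (t : Site (F.P K) (k + 1)),
      let e : Site (F.P K) (k + 1) → TPt 4 (domCount (F.P K) M (k + 1) * M) := fun x i => (ZMod.cast (x i) : ZMod (domCount (F.P K) M (k + 1) * M))
      w K k X t ≤ B₃ * Real.exp (-δ₀ * distCT (domCount (F.P K) M (k + 1)) M (e t) (nearT (M := M) (e t) X))) :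
    ∀ g ∈ Window γ, ∀ (k : ℕ) (μ ν : Fin 4) (z : Fin 4 → ℤ) (i : ℕ), i < k + 1 → ∀ t d : ℝ, 0 < d →
      t - d ∈ Ioc (0 : ℝ) γ → t + d ∈ Ioc (0 : ℝ) γ → ∀ᶠ K in atTop,
        |polWindow F K (k + 1) (localizedSum F S emb k (histPrefix (Function.update g i (t + d)) k) K) ρ bV μ ν z -
            2 * polWindow F K (k + 1) (localizedSum F S emb k (histPrefix (Function.update g i t) k) K) ρ bV μ ν z +
            polWindow F K (k + 1) (localizedSum F S emb k (histPrefix (Function.update g i (t - d)) k) K) ρ bV μ ν z| ≤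
          (16 * M₂ k i * B₃ ^ 2 / r ^ 2) * Real.exp (delta1 δ₀ κ ((M : ℝ) * 4) * ((M : ℝ) * 4) * 3) * K₀ (4 * 2 ^ 4) (2 * 4) *
            K₁ 4 (δ₀ / 2) * d ^ 2 * Real.exp (-(delta1 δ₀ κ ((M : ℝ) * 4) * l1 z)) := by
  intro g hg k μ ν z i hi t d hd hmI hpI
  have htI : t ∈ Ioc (0 : ℝ) γ := ⟨by linarith [hmI.1], by linarith [hpI.2]⟩
  have hM₂ki : 0 ≤ M₂ k i := hM₂ k i
  -- the three updated histories are window histories; their prefixes are updates of the prefix of `g`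
  have hgp : Function.update g i (t + d) ∈ Window γ := update_mem_window hg i hpI
  have hg0 : Function.update g i t ∈ Window γ := update_mem_window hg i htI
  have hgm : Function.update g i (t - d) ∈ Window γ := update_mem_window hg i hmI
  have hbox : histPrefix g k ∈ box γ k := YMDAG.N22.WindowedOfCouplingHolo.histPrefix_mem_box hg k
  set iF : Fin (k + 1) := ⟨i, hi⟩ with hiF
  have ep : histPrefix (Function.update g i (t + d)) k = Function.update (histPrefix g k) iF (t + d) := histPrefix_update g k hi _
  have e0 : histPrefix (Function.update g i t) k = Function.update (histPrefix g k) iF t := histPrefix_update g k hi _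
  have em : histPrefix (Function.update g i (t - d)) k = Function.update (histPrefix g k) iF (t - d) := histPrefix_update g k hi _
  -- the per-term second-difference bound on the complexified probe ball (the letter at `φ := Φ K k X z ∈ sp`, coordinate `(k, i)`)
  have hMx : ∀ (K : ℕ) (X : (domSys (F.P K) M (k + 1)).Dom), ∀ zz ∈ ball (0 : Ec K k) r,
      ‖((S K) k).E (histPrefix (Function.update g i (t + d)) k) (Φ K k X zz) X - 2 * ((S K) k).E (histPrefix (Function.update g i t) k) (Φ K k X zz) X +
          ((S K) k).E (histPrefix (Function.update g i (t - d)) k) (Φ K k X zz) X‖ ≤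
        M₂ k i * Real.exp (-(κE * (domSys (F.P K) M (k + 1)).dj X)) * d ^ 2 := by
    intro K X zz hzz
    rw [ep, e0, em]
    exact hΔ K k iF (histPrefix g k) hbox X (Φ K k X zz) (hΦsp K k X zz hzz) t d hd hmI hpI
  have hD : ∀ K : ℕ,
      |polWindow F K (k + 1) (localizedSum F S emb k (histPrefix (Function.update g i (t + d)) k) K) ρ bV μ ν z -
          2 * polWindow F K (k + 1) (localizedSum F S emb k (histPrefix (Function.update g i t) k) K) ρ bV μ ν z +
          polWindow F K (k + 1) (localizedSum F S emb k (histPrefix (Function.update g i (t - d)) k) K) ρ bV μ ν z| ≤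
        ∑ X : (domSys (F.P K) M (k + 1)).Dom, 16 * (M₂ k i * Real.exp (-(κE * torusTreeLen X.1)) * d ^ 2) / r ^ 2 *
          (w K k X (siteOfInt F K (k + 1) z) * w K k X (siteOfInt F K (k + 1) 0)) := fun K =>
    abs_secondDiff_polWindow_localizedSum_le_soft F S emb ρ bV k K _ _ _ (ι K k)
      (fun X zz => ((S K) k).E (histPrefix (Function.update g i (t + d)) k) (Φ K k X zz) X)
      (fun X zz => ((S K) k).E (histPrefix (Function.update g i t) k) (Φ K k X zz) X)
      (fun X zz => ((S K) k).E (histPrefix (Function.update g i (t - d)) k) (Φ K k X zz) X)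
      (U K k) (hU K k) (fun X => hEhol _ hgp K k X) (fun X => hEhol _ hg0 K k X) (fun X => hEhol _ hgm K k X) hr (hrU K k)
      (fun X Bf => by rw [expChart_apply, hΦemb]) (fun X Bf => by rw [expChart_apply, hΦemb]) (fun X Bf => by rw [expChart_apply, hΦemb])
      (fun X => M₂ k i * Real.exp (-(κE * torusTreeLen X.1)) * d ^ 2) (fun X zz hzz => hMx K X zz hzz) (w K k) (hw₀ K k) (hw K k) μ ν z
  -- soft majorants with the letter `M₂ k i·d²` in the place of `B`
  have hB' : 0 ≤ M₂ k i * d ^ 2 := by positivity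
  have hCE : (0 : ℝ) ≤ 16 * (M₂ k i * d ^ 2) * B₃ ^ 2 / r ^ 2 := by positivity
  have h := eventually_le_of_softSum_domSys F (k + 1) m' M hM
    (fun K => |polWindow F K (k + 1) (localizedSum F S emb k (histPrefix (Function.update g i (t + d)) k) K) ρ bV μ ν z -
        2 * polWindow F K (k + 1) (localizedSum F S emb k (histPrefix (Function.update g i t) k) K) ρ bV μ ν z +
        polWindow F K (k + 1) (localizedSum F S emb k (histPrefix (Function.update g i (t - d)) k) K) ρ bV μ ν z|)
    (fun K X => 16 * (M₂ k i * Real.exp (-(κE * torusTreeLen X.1)) * d ^ 2) / r ^ 2 *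
      (w K k X (siteOfInt F K (k + 1) z) * w K k X (siteOfInt F K (k + 1) 0)))
    hCE zero_le_one hδ₀ hκ₀ z hD (fun K X => ?_)
  · filter_upwards [h] with K hK
    refine hK.trans (le_of_eq ?_)
    ring
  · have e : 16 * (M₂ k i * Real.exp (-(κE * torusTreeLen X.1)) * d ^ 2) / r ^ 2 *
        (w K k X (siteOfInt F K (k + 1) z) * w K k X (siteOfInt F K (k + 1) 0)) =
        16 * ((M₂ k i * d ^ 2) * Real.exp (-(κE * torusTreeLen X.1))) / r ^ 2 *
          (w K k X (siteOfInt F K (k + 1) z) * w K k X (siteOfInt F K (k + 1) 0)) := by ring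
    rw [e]
    exact outputValueSummand_le_softMajorant hB' hr hB₃ (hw₀ K k X _) (Real.exp_nonneg _) (Real.exp_nonneg _) (htail K k X _) (htail K k X _) hκE
      (torusTreeLen_nonneg _)

end Letter

/-! ## §2 (R₂) at the kernel functional of record from the coordinate-dependent term-level letter (J45 §3, pointwise) -/

section Record

variable (F : T4Family) (N : ℕ) [NeZero N] {𝔸 : Type*} {M : ℕ}

open Classical in
/-- ★ **(R₂) AT THE KERNEL FUNCTIONAL OF RECORD FROM A COORDINATE-DEPENDENT TERM-LEVEL LETTER.**  J45 §3 `kernelSecondDiff_objectsOfRecord₁₃_of_termSecondDiff` with the table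
`M₂ k i`: towers `S K` read through `emb : ReadingMaps F (MatA N) 𝔸` with W1-20's law `Localizes17OfRecord₁₃ F N θ S emb`; §1's inputs at the chart of record `θ.ρ8 ∕ θ.bV`;
`PolLimitsExistOfRecord₁₃ F N θ` ⟹ at every point `X` of the kernel carrier (level `scale X − 1`) and young coordinate `i` the second differences of the limiting kernel of
record on `]0, θ.γ]` are `≤ C₂(M₂ (scale X − 1) i)·e^{−δ₁ d(X)}·d²`, `C₂(m) = (16mB₃²∕r²)·e^{12Mδ₁}·K₀·K₁` — §1 + the law at the three histories + J38's
`abs_secondDiff_le_of_tendsto`.  J45 §3's proof verbatim. [folklore] -/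
theorem kernelSecondDiff_objectsOfRecord₁₃_of_termSecondDiffAt (θ : Stage13Params F N) (ℓ : U3Letters₁₁) (hlim : PolLimitsExistOfRecord₁₃ F N θ)
    (m' : ℕ) (M : ℕ) [NeZero M] (hM : M = F.L ^ m')
    (S : (K : ℕ) → ClusterTower (F.P K) 𝔸 M) (emb : ReadingMaps F (MatA N) 𝔸) (hloc : Localizes17OfRecord₁₃ F N θ S emb)
    (sp : (K k : ℕ) → (domSys (F.P K) M (k + 1)).Dom → Set (CPair (F.P K) 𝔸))
    {κ κE δ₀ B₃ r : ℝ} {M₂ : ℕ → ℕ → ℝ}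
    (hκ₀ : kappa₀ (4 * 2 ^ 4) (2 * 4) ≤ κ / 2) (hδ₀ : 0 < δ₀) (hB₃ : 0 ≤ B₃) (hr : 0 < r) (hM₂ : ∀ k i, 0 ≤ M₂ k i) (hκE : κ ≤ κE)
    (hΔ : ∀ (K k : ℕ) (i : Fin (k + 1)), ∀ g ∈ box θ.γ k, ∀ (X : (domSys (F.P K) M (k + 1)).Dom), ∀ φ ∈ sp K k X, ∀ t d : ℝ, 0 < d →
      t - d ∈ Ioc (0 : ℝ) θ.γ → t + d ∈ Ioc (0 : ℝ) θ.γ →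
        ‖((S K) k).E (Function.update g i (t + d)) φ X - 2 * ((S K) k).E (Function.update g i t) φ X + ((S K) k).E (Function.update g i (t - d)) φ X‖ ≤
          M₂ k i * Real.exp (-(κE * (domSys (F.P K) M (k + 1)).dj X)) * d ^ 2)
    (Ec : ℕ → ℕ → Type*) [∀ K k, NormedAddCommGroup (Ec K k)] [∀ K k, NormedSpace ℂ (Ec K k)]
    (ι : letI := θ.instVβ₁; letI := θ.instVβ₂
      (K k : ℕ) → (domSys (F.P K) M (k + 1)).Dom → ((Fin (F.P K).d → Site (F.P K) (k + 1) → θ.Vβ) →L[ℝ] Ec K k))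
    (Φ : (K k : ℕ) → (domSys (F.P K) M (k + 1)).Dom → Ec K k → CPair (F.P K) 𝔸)
    (U : (K k : ℕ) → (domSys (F.P K) M (k + 1)).Dom → Set (Ec K k)) (hU : ∀ K k X, IsOpen (U K k X)) (hrU : ∀ K k X, ball (0 : Ec K k) r ⊆ U K k X)
    (hEhol : ∀ g ∈ Window θ.γ, ∀ (K k : ℕ) (X : (domSys (F.P K) M (k + 1)).Dom),
      DifferentiableOn ℂ (fun z => ((S K) k).E (histPrefix g k) (Φ K k X z) X) (U K k X))
    (hΦemb : letI := θ.instVβ₁; letI := θ.instVβ₂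
      ∀ (K k : ℕ) (X : (domSys (F.P K) M (k + 1)).Dom) (Bf : Fin (F.P K).d → Site (F.P K) (k + 1) → θ.Vβ),
        Φ K k X (ι K k X Bf) = emb K k (fun l t => NormedSpace.exp (θ.ρ8 (Bf l t))))
    (hΦsp : ∀ (K k : ℕ) (X : (domSys (F.P K) M (k + 1)).Dom), ∀ z ∈ ball (0 : Ec K k) r, Φ K k X z ∈ sp K k X)
    (w : (K k : ℕ) → (domSys (F.P K) M (k + 1)).Dom → Site (F.P K) (k + 1) → ℝ) (hw₀ : ∀ K k X t, 0 ≤ w K k X t)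
    (hw : letI := θ.instVβ₁; letI := θ.instVβ₂; letI := θ.instιβ
      ∀ (K k : ℕ) (X : (domSys (F.P K) M (k + 1)).Dom) (l : Fin (F.P K).d) (t : Site (F.P K) (k + 1)) (c : θ.ιβ),
        ‖ι K k X (Pi.single l (Pi.single t (θ.bV c)))‖ ≤ w K k X t)
    (htail : ∀ (K k : ℕ) (X : (domSys (F.P K) M (k + 1)).Dom) (t : Site (F.P K) (k + 1)),
      let e : Site (F.P K) (k + 1) → TPt 4 (domCount (F.P K) M (k + 1) * M) := fun x i => (ZMod.cast (x i) : ZMod (domCount (F.P K) M (k + 1) * M))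
      w K k X t ≤ B₃ * Real.exp (-δ₀ * distCT (domCount (F.P K) M (k + 1)) M (e t) (nearT (M := M) (e t) X))) :
    ∀ g ∈ Window θ.γ, ∀ (Uu : PUnit) (X : ((objectsOfRecord₁₃ F N θ ℓ).levelCarriers 0).Dom) (i : ℕ),
      i < ((objectsOfRecord₁₃ F N θ ℓ).levelCarriers 0).scale X → ∀ t d : ℝ, 0 < d → t - d ∈ Ioc (0 : ℝ) θ.γ → t + d ∈ Ioc (0 : ℝ) θ.γ →
        |(objectsOfRecord₁₃ F N θ ℓ).EA 0 (Function.update g i (t + d)) Uu X - 2 * (objectsOfRecord₁₃ F N θ ℓ).EA 0 (Function.update g i t) Uu X +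
            (objectsOfRecord₁₃ F N θ ℓ).EA 0 (Function.update g i (t - d)) Uu X| ≤
          (16 * M₂ (((objectsOfRecord₁₃ F N θ ℓ).levelCarriers 0).scale X - 1) i * B₃ ^ 2 / r ^ 2) *
            Real.exp (delta1 δ₀ κ ((M : ℝ) * 4) * ((M : ℝ) * 4) * 3) * K₀ (4 * 2 ^ 4) (2 * 4) * K₁ 4 (δ₀ / 2) *
            Real.exp (-(delta1 δ₀ κ ((M : ℝ) * 4) * ((objectsOfRecord₁₃ F N θ ℓ).levelCarriers 0).d X)) * d ^ 2 := by
  letI := θ.instVβ₁; letI := θ.instVβ₂; letI := θ.instιβ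
  intro g hg Uu X i hi t d hd hm hp
  obtain ⟨k, μ, ν, z⟩ := X
  -- §1 at the reading of record
  have hW := windowedSecondDiff_localizedSum_of_termSecondDiffAt F m' M hM S emb θ.ρ8 θ.bV sp hκ₀ hδ₀ hB₃ hr hM₂ hκE hΔ Ec ι Φ U hU hrU hEhol hΦemb hΦsp
    w hw₀ hw htail g hg k μ ν z i hi t d hd hm hp
  -- transfer to the merged term family of record by W1-20's law, at the three updated histories
  have hA := hloc.eventuallyAgree F
  have ep := polWindow_eventuallyEq_of_eventuallyAgree F θ.ρ8 θ.bV hA (Function.update g i (t + d)) k μ ν z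
  have e0 := polWindow_eventuallyEq_of_eventuallyAgree F θ.ρ8 θ.bV hA (Function.update g i t) k μ ν z
  have em := polWindow_eventuallyEq_of_eventuallyAgree F θ.ρ8 θ.bV hA (Function.update g i (t - d)) k μ ν z
  have hW' : ∀ᶠ K in atTop,
      |polWindow F K (k + 1) (mergedTermFamilyMatT F N (TβOfRecord₁₃ F N) (chiβOfRecord₁₃ F N θ) θ.εbg k (histPrefix (Function.update g i (t + d)) k) K) θ.ρ8 θ.bV μ ν z -
          2 * polWindow F K (k + 1) (mergedTermFamilyMatT F N (TβOfRecord₁₃ F N) (chiβOfRecord₁₃ F N θ) θ.εbg k (histPrefix (Function.update g i t) k) K) θ.ρ8 θ.bV μ ν z +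
          polWindow F K (k + 1) (mergedTermFamilyMatT F N (TβOfRecord₁₃ F N) (chiβOfRecord₁₃ F N θ) θ.εbg k (histPrefix (Function.update g i (t - d)) k) K) θ.ρ8 θ.bV μ ν z| ≤
        (16 * M₂ k i * B₃ ^ 2 / r ^ 2) * Real.exp (delta1 δ₀ κ ((M : ℝ) * 4) * ((M : ℝ) * 4) * 3) * K₀ (4 * 2 ^ 4) (2 * 4) * K₁ 4 (δ₀ / 2) * d ^ 2 *
          Real.exp (-(delta1 δ₀ κ ((M : ℝ) * 4) * l1 z)) := by
    filter_upwards [hW, ep, e0, em] with K hK hKp hK0 hKm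
    rw [hKp, hK0, hKm]; exact hK
  -- (1.21) passage at the three histories
  have ht : t ∈ Ioc (0 : ℝ) θ.γ := ⟨by linarith [hm.1], by linarith [hp.2]⟩
  have hl := (polLimitsExistOfRecord₁₃_iff F N θ).1 hlim
  show |kernelA F (mergedTermFamilyMatT F N (TβOfRecord₁₃ F N) (chiβOfRecord₁₃ F N θ) θ.εbg) θ.ρ8 θ.bV (Function.update g i (t + d)) k μ ν z -
      2 * kernelA F (mergedTermFamilyMatT F N (TβOfRecord₁₃ F N) (chiβOfRecord₁₃ F N θ) θ.εbg) θ.ρ8 θ.bV (Function.update g i t) k μ ν z +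
      kernelA F (mergedTermFamilyMatT F N (TβOfRecord₁₃ F N) (chiβOfRecord₁₃ F N θ) θ.εbg) θ.ρ8 θ.bV (Function.update g i (t - d)) k μ ν z| ≤
    (16 * M₂ k i * B₃ ^ 2 / r ^ 2) * Real.exp (delta1 δ₀ κ ((M : ℝ) * 4) * ((M : ℝ) * 4) * 3) * K₀ (4 * 2 ^ 4) (2 * 4) * K₁ 4 (δ₀ / 2) *
      Real.exp (-(delta1 δ₀ κ ((M : ℝ) * 4) * l1 z)) * d ^ 2
  rw [kernelA_eq, kernelA_eq, kernelA_eq]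
  refine (abs_secondDiff_le_of_tendsto
    (Node00.tendsto_polLimit F (k + 1) _ θ.ρ8 θ.bV (hl _ (update_mem_window hg i hp) k) μ ν z)
    (Node00.tendsto_polLimit F (k + 1) _ θ.ρ8 θ.bV (hl _ (update_mem_window hg i ht) k) μ ν z)
    (Node00.tendsto_polLimit F (k + 1) _ θ.ρ8 θ.bV (hl _ (update_mem_window hg i hm) k) μ ν z) hW').trans (le_of_eq ?_)
  ring

end Record

/-! ## §3 Generic term family `ℰ`: the knit at a general AGE-GROWTH ratio `q` (J38 §2 with dag-n22-a's `(μ, ρ, τ)` bookkeeping displayed) -/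

section Generic

variable {𝔄 : Type*} [NormedRing 𝔄] [NormedAlgebra ℝ 𝔄]
variable {V : Type*} [NormedAddCommGroup V] [NormedSpace ℝ V] {ι : Type*} [Fintype ι]
variable (F : T4Family) (ℰ : TermFamily1 F 𝔄) (ρ : V →L[ℝ] 𝔄) (bV : Module.Basis ι ℝ V)

/-- ★★★ **NE9 ∧ FADING MEMORY OF THE KERNEL FUNCTIONAL FROM NODE N18's KERNEL STEP RATE + UNIFORM DECAY + SECOND DIFFERENCES GROWING GEOMETRICALLY IN THE AGE.**  For a term
family `ℰ` on the window `]0, γ]^ℕ` (`γ > 0`): (N18) `KernelStepRate F ℰ ρ bV γ κ θ C₅` (`C₅ ≥ 0`, `0 ≤ θ < 1`); (1.18) `DecayBound (EA F ℰ ρ bV) (Window γ) E₀ κ` (`E₀ ≥ 0`);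
(R₂) second differences of every kernel entry in every young coupling `i ≤ k` on `]0, γ]` bounded by `M·q^{k−i}·e^{−κ|z|₁}·d²` (`M, q ≥ 0` — the constant may GROW geometrically
in the age `k − i` of the coordinate); a step ratio `ϱ ∈ ]0, 1]` and a rate `τ > 0` with `θ ≤ τϱ`, `qϱ ≤ τ` ⟹ **`NE9 (EA F ℰ ρ bV) (Window γ) κ Λ₁ ∧ FadingMemory C₉ τ Λ₁`**,
`Λ₁ k i = C₉·τ^{k−i}`, `C₉ = (4C₀∕γ + Mγ∕2)∕τ`, `C₀ = 2C₅∕(1−θ) + 2E₀` — dag-n22-a's `N22KnitDiscrete.ne9_and_fadingMemory_of_osc_secondDiff` at J38 §1's (P) and (O), its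
growth letter `μ := q` DISPLAYED (J38 §2 is `q = 1`).  Fading (`τ < 1`) is available iff `θq < 1` (best rate `√(θq)`, dag-n22-w1's `…N22KnitRoadRatesSharp`). [folklore] -/
theorem ne9_and_fadingMemory_EA_of_kernelStepRate_secondDiffGrowing {γ κ θ C₅ E₀ M q ϱ τ : ℝ}
    (hC₅ : 0 ≤ C₅) (hθ0 : 0 ≤ θ) (hθ1 : θ < 1) (hE₀ : 0 ≤ E₀) (hM : 0 ≤ M) (hq : 0 ≤ q) (hγ : 0 < γ)
    (h5 : KernelStepRate F ℰ ρ bV γ κ θ C₅) (hdec : DecayBound (EA F ℰ ρ bV) (Window γ) E₀ κ)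
    (hR2 : ∀ g ∈ Window γ, ∀ (k : ℕ) (μ ν : Fin 4) (z : Fin 4 → ℤ) (i : ℕ), i < k + 1 → ∀ t d : ℝ, 0 < d →
      t - d ∈ Ioc (0 : ℝ) γ → t + d ∈ Ioc (0 : ℝ) γ →
        |kernelA F ℰ ρ bV (Function.update g i (t + d)) k μ ν z - 2 * kernelA F ℰ ρ bV (Function.update g i t) k μ ν z +
            kernelA F ℰ ρ bV (Function.update g i (t - d)) k μ ν z| ≤ M * q ^ (k - i) * Real.exp (-(κ * l1 z)) * d ^ 2)
    (hϱ0 : 0 < ϱ) (hϱ1 : ϱ ≤ 1) (hθτϱ : θ ≤ τ * ϱ) (hqϱτ : q * ϱ ≤ τ) (hτ0 : 0 < τ) :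
    NE9 (EA F ℰ ρ bV) (Window γ) κ
        (fun k i => (4 * (2 * C₅ / (1 - θ) + 2 * E₀) / γ + M * γ / 2) / τ * τ ^ (k - i)) ∧
      FadingMemory ((4 * (2 * C₅ / (1 - θ) + 2 * E₀) / γ + M * γ / 2) / τ) τ
        (fun k i => (4 * (2 * C₅ / (1 - θ) + 2 * E₀) / γ + M * γ / 2) / τ * τ ^ (k - i)) := by
  have h1θ : 0 < 1 - θ := by linarith
  have hC₀ : 0 ≤ 2 * C₅ / (1 - θ) + 2 * E₀ := by positivity
  have hR2' : ∀ g ∈ Window γ, ∀ (U : PUnit) (X : carriers.Dom) (i : ℕ), i < carriers.scale X → ∀ t d : ℝ, 0 < d →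
      t - d ∈ Ioc (0 : ℝ) γ → t + d ∈ Ioc (0 : ℝ) γ →
        |EA F ℰ ρ bV (Function.update g i (t + d)) U X - 2 * EA F ℰ ρ bV (Function.update g i t) U X +
            EA F ℰ ρ bV (Function.update g i (t - d)) U X| ≤
          M * q ^ (carriers.scale X - 1 - i) * Real.exp (-(κ * carriers.d X)) * d ^ 2 := by
    intro g hg U X i hi t d hd hm hp
    obtain ⟨k, μ, ν, z⟩ := X
    rw [EA_apply, EA_apply, EA_apply]
    -- `carriers.scale (k, μ, ν, z) - 1 - i = k + 1 - 1 - i ≡ k - i` definitionally (`Nat.succ_sub_one`)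
    exact hR2 g hg k μ ν z i hi t d hd hm hp
  exact ne9_and_fadingMemory_of_osc_secondDiff (C := carriers) (E := EA F ℰ ρ bV) (prefixDependenceOn_EA F ℰ ρ bV (Window γ))
    (osc_EA_of_kernelStepRate_decayBound F ℰ ρ bV hC₅ hθ0 hθ1 hE₀ h5 hdec) hR2' hC₀ hθ0 hM hq hγ hϱ0 hϱ1 hθτϱ hqϱτ hτ0

end Generic

/-! ## §4 At the objects of record: K3's `h9` with the moduli `ℓ.moduli` under the row `ℓ.θ₅·q ≤ ℓ.ω²` -/

section AtRecord

variable (F : T4Family) (N : ℕ) [NeZero N]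

/-- ★★★ **K3's `h9` WITH THE RECORD's MODULI FROM NODE N18's KERNEL STEP RATE OF RECORD + UNIFORM KERNEL DECAY + SECOND DIFFERENCES GROWING GEOMETRICALLY IN THE AGE.**  At a
Stage-13 tuple `θ` (`0 < θ.γ`) with a letter block `ℓ` (`ℓ.Signs`): (N18) `KernelStepRateOfRecord₁₃ F N θ κ ℓ.θ₅ C₅` (`C₅ ≥ 0`); (1.18) `DecayBound ((objectsOfRecord₁₃ F N θ ℓ).EA 0)
(Window θ.γ) E₀ κ` (`E₀ ≥ 0`); (R₂) second differences of the kernel functional of record in every young coupling `i` on `]0, θ.γ]` bounded by `M·q^{scale X − 1 − i}·e^{−κd(X)}·d²`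
(`M ≥ 0`; AGE-GROWTH ratio `q ≥ 1`); the LETTER ROWS `0 < ℓ.ω`, **`ℓ.θ₅·q ≤ ℓ.ω²`**, `ℓ.κ ≤ κ`, `(4·(2C₅∕(1−ℓ.θ₅) + 2E₀)∕θ.γ + M·θ.γ∕2)∕ℓ.ω ≤ ℓ.C₉` ⟹
**`NE9 ((objectsOfRecord₁₃ F N θ ℓ).EA 0) (Window θ.γ) ℓ.κ ℓ.moduli`** — §3 at `τ := ℓ.ω`, `ϱ := ℓ.ω∕q` (`ϱ ≤ 1` since `ℓ.ω < 1 ≤ q`; `θ₅ ≤ τϱ = ω²∕q`; `qϱ = ω`), then J38's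
`ne9_mono`.  `q = 1` is J38 §3 (`ℓ.θ₅ ≤ ℓ.ω²`); for `q > 1` the row asks `ℓ.ω ≥ √(θ₅q)` — ROAD 2's full window (fading available iff `θ₅q < 1`).  The rows are jointly satisfiable
with `ℓ.Signs` whenever `θ₅q < 1` (`ℓ.ω ∈ [√(θ₅q), 1[`, `ℓ.C₉` large).  LOCATED (hypothesis form); N22 NOT discharged. [folklore] -/
theorem ne9_EA_objectsOfRecord₁₃_of_kernelStepRate_secondDiffGrowing (θ : Stage13Params F N) (ℓ : U3Letters₁₁) (hs : ℓ.Signs) (hγ : 0 < θ.γ)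
    {κ C₅ E₀ M q : ℝ} (hC₅ : 0 ≤ C₅) (hE₀ : 0 ≤ E₀) (hM : 0 ≤ M) (hq : 1 ≤ q)
    (h5 : KernelStepRateOfRecord₁₃ F N θ κ ℓ.θ₅ C₅)
    (hdec : DecayBound ((objectsOfRecord₁₃ F N θ ℓ).EA 0) (Window θ.γ) E₀ κ)
    (hR2 : ∀ g ∈ Window θ.γ, ∀ (U : PUnit) (X : ((objectsOfRecord₁₃ F N θ ℓ).levelCarriers 0).Dom) (i : ℕ),
      i < ((objectsOfRecord₁₃ F N θ ℓ).levelCarriers 0).scale X → ∀ t d : ℝ, 0 < d → t - d ∈ Ioc (0 : ℝ) θ.γ → t + d ∈ Ioc (0 : ℝ) θ.γ →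
        |(objectsOfRecord₁₃ F N θ ℓ).EA 0 (Function.update g i (t + d)) U X - 2 * (objectsOfRecord₁₃ F N θ ℓ).EA 0 (Function.update g i t) U X +
            (objectsOfRecord₁₃ F N θ ℓ).EA 0 (Function.update g i (t - d)) U X| ≤
          M * q ^ (((objectsOfRecord₁₃ F N θ ℓ).levelCarriers 0).scale X - 1 - i) *
            Real.exp (-(κ * ((objectsOfRecord₁₃ F N θ ℓ).levelCarriers 0).d X)) * d ^ 2)
    (hω : 0 < ℓ.ω) (hθω : ℓ.θ₅ * q ≤ ℓ.ω ^ 2) (hκ : ℓ.κ ≤ κ)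
    (hC₉ : (4 * (2 * C₅ / (1 - ℓ.θ₅) + 2 * E₀) / θ.γ + M * θ.γ / 2) / ℓ.ω ≤ ℓ.C₉) :
    NE9 ((objectsOfRecord₁₃ F N θ ℓ).EA 0) (Window θ.γ) ℓ.κ ℓ.moduli := by
  letI := θ.instVβ₁; letI := θ.instVβ₂; letI := θ.instιβ
  have hq0 : 0 < q := lt_of_lt_of_le one_pos hq
  have hR2' : ∀ g ∈ Window θ.γ, ∀ (k : ℕ) (μ ν : Fin 4) (z : Fin 4 → ℤ) (i : ℕ), i < k + 1 → ∀ t d : ℝ, 0 < d →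
      t - d ∈ Ioc (0 : ℝ) θ.γ → t + d ∈ Ioc (0 : ℝ) θ.γ →
        |kernelA F (mergedTermFamilyMatT F N (TβOfRecord₁₃ F N) (chiβOfRecord₁₃ F N θ) θ.εbg) θ.ρ8 θ.bV (Function.update g i (t + d)) k μ ν z -
            2 * kernelA F (mergedTermFamilyMatT F N (TβOfRecord₁₃ F N) (chiβOfRecord₁₃ F N θ) θ.εbg) θ.ρ8 θ.bV (Function.update g i t) k μ ν z +
            kernelA F (mergedTermFamilyMatT F N (TβOfRecord₁₃ F N) (chiβOfRecord₁₃ F N θ) θ.εbg) θ.ρ8 θ.bV (Function.update g i (t - d)) k μ ν z| ≤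
          M * q ^ (k - i) * Real.exp (-(κ * l1 z)) * d ^ 2 :=
    fun g hg k μ ν z i hi t d hd hm hp => hR2 g hg PUnit.unit (k, μ, ν, z) i hi t d hd hm hp
  -- §3 at `τ := ℓ.ω`, `ϱ := ℓ.ω / q`
  have hϱ0 : 0 < ℓ.ω / q := div_pos hω hq0
  have hϱ1 : ℓ.ω / q ≤ 1 := by
    rw [div_le_one hq0]
    exact hs.ω_lt_one.le.trans hq
  have hθτϱ : ℓ.θ₅ ≤ ℓ.ω * (ℓ.ω / q) := by
    rw [← mul_div_assoc, ← sq, le_div_iff₀ hq0]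
    exact hθω
  have hqϱτ : q * (ℓ.ω / q) ≤ ℓ.ω := by
    rw [mul_div_cancel₀ _ hq0.ne']
  have h := ne9_and_fadingMemory_EA_of_kernelStepRate_secondDiffGrowing F
    (mergedTermFamilyMatT F N (TβOfRecord₁₃ F N) (chiβOfRecord₁₃ F N θ) θ.εbg) θ.ρ8 θ.bV hC₅ hs.θ₅_pos.le hs.θ₅_lt_one hE₀ hM hq0.le hγ h5 hdec hR2'
    hϱ0 hϱ1 hθτϱ hqϱτ hω
  refine ne9_mono h.1 hκ (fun k i => ?_) (hs.moduli_nonneg)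
  rw [U3Letters₁₁.moduli_apply]
  exact mul_le_mul_of_nonneg_right hC₉ (pow_nonneg hs.ω_nonneg _)

end AtRecord

/-! ## §5 The growth rows are jointly satisfiable with `ℓ.Signs` (A5 rider; J42 §2 at ratio `q`) -/

/-- ★ **NON-VACUITY OF THE GROWTH ROWS.**  For every NE5 rate `θ₅ ∈ ]0, 1[`, growth ratio `q ≥ 1` with `θ₅·q < 1`, constants `C₅, E₁, C₂ ≥ 0`, window radius `γ > 0` and decay
`δ₁ ≥ 0` there IS a letter block `ℓ` with `ℓ.Signs`, `ℓ.θ₅ = θ₅`, `ℓ.κ = δ₁`, `ℓ.C₅ = C₅` and the rows of §4: `0 < ℓ.ω`, `ℓ.θ₅·q ≤ ℓ.ω²`, `ℓ.κ ≤ δ₁`,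
`(4·(2C₅∕(1−θ₅) + 2E₁)∕γ + C₂γ∕2)∕ℓ.ω ≤ ℓ.C₉` — take `ω = ρ := (1 + √(θ₅q))∕2`, `C₉ :=` the left member, `cr := 0` (J42 §2 `exists_letterBlock_rows` is `q = 1`).  The condition
`θ₅·q < 1` is also NECESSARY for a block with `ℓ.Signs` (`ℓ.ω < 1`): ROAD 2's window exactly. [folklore] -/
theorem exists_letterBlock_rows_growing {θ₅ q C₅ E₁ C₂ γ δ₁ : ℝ} (hθ0 : 0 < θ₅) (hθ1 : θ₅ < 1) (hq : 1 ≤ q) (hθq : θ₅ * q < 1)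
    (hC₅ : 0 ≤ C₅) (hE₁ : 0 ≤ E₁) (hC₂ : 0 ≤ C₂) (hγ : 0 < γ) (hδ₁ : 0 ≤ δ₁) :
    ∃ ℓ : U3Letters₁₁, ℓ.Signs ∧ ℓ.θ₅ = θ₅ ∧ ℓ.κ = δ₁ ∧ ℓ.C₅ = C₅ ∧ 0 < ℓ.ω ∧ ℓ.θ₅ * q ≤ ℓ.ω ^ 2 ∧ ℓ.κ ≤ δ₁ ∧
      (4 * (2 * C₅ / (1 - ℓ.θ₅) + 2 * E₁) / γ + C₂ * γ / 2) / ℓ.ω ≤ ℓ.C₉ := by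
  have hq0 : 0 < q := lt_of_lt_of_le one_pos hq
  have hθq0 : 0 < θ₅ * q := mul_pos hθ0 hq0
  set s : ℝ := Real.sqrt (θ₅ * q) with hs
  have hs0 : 0 ≤ s := Real.sqrt_nonneg _
  have hs1 : s < 1 := by rw [hs, Real.sqrt_lt' one_pos]; simpa using hθq
  have hss : s ^ 2 = θ₅ * q := by rw [hs, Real.sq_sqrt hθq0.le]
  set ω : ℝ := (1 + s) / 2 with hω
  have hω0 : 0 < ω := by rw [hω]; linarith
  have hω1 : ω < 1 := by rw [hω]; linarith
  have hsω : s ≤ ω := by rw [hω]; linarith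
  have hθω : θ₅ * q ≤ ω ^ 2 := by
    rw [← hss]; exact pow_le_pow_left₀ hs0 hsω 2
  have hθω' : θ₅ ≤ ω := by
    have h1 : θ₅ ≤ θ₅ * q := le_mul_of_one_le_right hθ0.le hq
    have h2 : ω ^ 2 ≤ ω := by nlinarith
    exact h1.trans (hθω.trans h2)
  have h1θ : 0 < 1 - θ₅ := by linarith
  set C₉ : ℝ := (4 * (2 * C₅ / (1 - θ₅) + 2 * E₁) / γ + C₂ * γ / 2) / ω with hC₉
  have hC₉0 : 0 ≤ C₉ := by rw [hC₉]; positivity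
  refine ⟨⟨δ₁, θ₅, C₅, C₉, ω, 0, ω⟩, ?_, rfl, rfl, rfl, hω0, hθω, le_rfl, le_rfl⟩
  exact { κ_nonneg := hδ₁, θ₅_pos := hθ0, θ₅_lt_one := hθ1, C₅_nonneg := hC₅, C₉_nonneg := hC₉0, ω_nonneg := hω0.le, ω_lt_one := hω1,
          cr_nonneg := le_rfl, θ₅_le_ρ := hθω', ω_le_ρ := le_rfl, ρ_lt_one := hω1 }

end YMDAG.N22.KernelFading

end
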